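import Mathlib
import HarnessLib
import Literature.Analysis.FluidPDE.IsometryInvariance
import Literature.Analysis.FluidPDE.AxisymmetricVorticityTransport
import Literature.Analysis.FluidPDE.AxisymHouLiVariables
import Summits.NavierStokesRegularity.NavierStokesRegularity.Theorems.PoloidalWindowDoorLrcModEntireTHCertDictionary

/-!
# Route `PoloidalWindowDoor`, crux `PoloidalWindowRigidity` (stmt-19708) / item `LrcModEntire` (stmt-20428) —
# the normal-form local (TH)∩twisting statement MAY ASSUME `∂₀u₂(p₀) = 0 < ∂₁u₂(p₀)` (horizontal rotation gauge)

Seat ns-poloidal-K2-p2 g8 (interim LEAD-of-record on 19708; file `--supports`).  Third free normalisation of the registered local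
statement of the (TH) column, after `…TwistingTHLocalNonUmbilic` (p585858, `f₀₂ ≠ 0`) and `…TwistingTHLocalGalilean` (p586459,
`u(p₀) = 0`): the local system {`∂₀u₁ = ∂₁u₀`, `div u = 0`, `∂₂u_b = μ(t,z)∂_bu₂`, E} is COVARIANT UNDER HORIZONTAL ROTATIONS
`R_θ` (`rotZ θ`, fixing the height axis): the conjugated datum `u′(t,y) = R_θ u(t, R_{−θ} y)`, `μ′ = μ`, `A′ = A` solves the same
system on `U′ = {(t,y) : (t, R_{−θ}y) ∈ U}` (the scalar law E only sees the vertical component `u₂ ∘ R_{−θ}`, the material derivative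
and `Δ`, all rotation invariant — `Literature.Analysis.FluidPDE.laplacian_comp_linearIsometryEquiv_symm`), every pin at
`p₀′ = (t₀, R_θ x₀)` is the pin at `p₀` (the twist and the non-umbilic pin are `SO(2)`-invariants, `u′(p₀′) = R_θ u(p₀) = 0`), and
the horizontal gradient of `u₂` at the base point is rotated by `θ`.  Since the twist pin forces `∇ₕu₂(p₀) ≠ 0`, the angle with
`cos θ = ∂₁u₂(p₀)/g`, `sin θ = ∂₀u₂(p₀)/g`, `g = |∇ₕu₂(p₀)|`, achieves `∂₀u′₂(p₀′) = 0`, `∂₁u′₂(p₀′) = g > 0`.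

* `localTHEmptyHypNF_of_rotation` — **`hemptyHypNF` ⇐ `hemptyHypNFR`**: the normal-form statement (binder of
  `…TwistingTHLocalNormalForm.localTHEmptyHyp_of_normalForm`, p586844) may ALSO assume
  `fderiv ℝ (u p₀.1) p₀.2 (EuclideanSpace.single 0 1) 2 = 0` and `0 < fderiv ℝ (u p₀.1) p₀.2 (EuclideanSpace.single 1 1) 2`.
  With the parabolic scaling (`…TwistingTHLocalScaling`) the second becomes `= 1`: the complex slice letter `w₁₀ = −i/2`
  (real letters `Rw_1_0 = 0`, `Iw_1_0 = −1/2`) of KERNEL-CERT-FORMAT-g8 §3, asked for by DIRECTOR-NS #103 (4).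

WHAT THIS IS NOT: not a proof of the stub and not a claim about Navier–Stokes regularity — a free normalisation of the registered
local statement (bears_on LADDER-NS N0 via crux 19708 / item 20428).
-/

noncomputable section

-- the summit and its single sub-problem share the name (CONVENTIONS §1), as in every Theorems file
set_option linter.dupNamespace false

namespace Summit.NavierStokesRegularity.NavierStokesRegularity.Theorems.PoloidalWindowDoorLrcModEntireTwistingTHLocalRotation

open Set Function Filter Topology Metric
open scoped RealInnerProductSpace InnerProductSpace Laplacian
open Literature.Analysis Literature.Analysis.FluidPDE
open Summit.NavierStokesRegularity.NavierStokesRegularity.Theorems.PoloidalWindowDoorLrcModEntireTHCertLetters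
open Summit.NavierStokesRegularity.NavierStokesRegularity.Theorems.PoloidalWindowDoorLrcModEntireTHCertDictionary

/-! ### The rotation on the coordinate directions -/

/-- `R_{−θ} e₀ = cos θ e₀ − sin θ e₁`. [folklore] -/
theorem rotZ_neg_single_zero (θ : ℝ) :
    rotZ (-θ) (EuclideanSpace.single 0 (1 : ℝ)) =
      Real.cos θ • EuclideanSpace.single 0 (1 : ℝ) - Real.sin θ • EuclideanSpace.single 1 (1 : ℝ) := by
  ext i
  fin_cases i <;> simp [Real.cos_neg, Real.sin_neg]

/-- `R_{−θ} e₁ = sin θ e₀ + cos θ e₁`. [folklore] -/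
theorem rotZ_neg_single_one (θ : ℝ) :
    rotZ (-θ) (EuclideanSpace.single 1 (1 : ℝ)) =
      Real.sin θ • EuclideanSpace.single 0 (1 : ℝ) + Real.cos θ • EuclideanSpace.single 1 (1 : ℝ) := by
  ext i
  fin_cases i <;> simp [Real.cos_neg, Real.sin_neg]

/-! ### Derivatives of the conjugated field `y ↦ R_θ v(R_{−θ} y)` -/

variable {F : Type*} [NormedAddCommGroup F] [NormedSpace ℝ F]

/-- Chain rule for the conjugated field: `D(R_θ v R_{−θ})(y) e = R_θ (Dv(R_{−θ}y)(R_{−θ}e))` (no differentiability hypothesis).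
[folklore] -/
theorem fderiv_rotConj (v : EuclideanSpace ℝ (Fin 3) → EuclideanSpace ℝ (Fin 3)) (θ : ℝ) (y e : EuclideanSpace ℝ (Fin 3)) :
    fderiv ℝ (fun z => rotZ θ (v (rotZ (-θ) z))) y e = rotZ θ (fderiv ℝ v (rotZ (-θ) y) (rotZ (-θ) e)) := by
  have h := fderiv_conj_linearIsometryEquiv (rotZLIE θ) v y
  have h' : (fun z => rotZ θ (v (rotZ (-θ) z))) = fun z => rotZLIE θ (v ((rotZLIE θ).symm z)) := rfl
  rw [h', h]
  rfl

/-- Chain rule for a scalar composed with `R_{−θ}`: `D(g ∘ R_{−θ})(y) e = Dg(R_{−θ}y)(R_{−θ}e)` (no differentiability hypothesis).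
[folklore] -/
theorem fderiv_comp_rotZ_neg (g : EuclideanSpace ℝ (Fin 3) → F) (θ : ℝ) (y e : EuclideanSpace ℝ (Fin 3)) :
    fderiv ℝ (fun z => g (rotZ (-θ) z)) y e = fderiv ℝ g (rotZ (-θ) y) (rotZ (-θ) e) := by
  have h := fderiv_comp_linearIsometryEquiv_symm (rotZLIE θ) g y
  have h' : (fun z => g (rotZ (-θ) z)) = fun z => g ((rotZLIE θ).symm z) := rfl
  rw [h', h]
  rfl

/-- The Laplacian of a scalar composed with `R_{−θ}`: `Δ(g ∘ R_{−θ})(y) = Δg(R_{−θ}y)` (no differentiability hypothesis).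
[folklore] -/
theorem laplacian_comp_rotZ_neg (g : EuclideanSpace ℝ (Fin 3) → F) (θ : ℝ) (y : EuclideanSpace ℝ (Fin 3)) :
    Δ (fun z => g (rotZ (-θ) z)) y = Δ g (rotZ (-θ) y) := by
  have h := laplacian_comp_linearIsometryEquiv_symm (rotZLIE θ) g y
  have h' : (fun z => g (rotZ (-θ) z)) = fun z => g ((rotZLIE θ).symm z) := rfl
  rw [h', h]
  rfl

/-- The vertical component of the conjugated field is `v₂ ∘ R_{−θ}`. [folklore] -/
theorem rotConj_vert (v : EuclideanSpace ℝ (Fin 3) → EuclideanSpace ℝ (Fin 3)) (θ : ℝ) :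
    (fun z => rotZ θ (v (rotZ (-θ) z)) 2) = fun z => v (rotZ (-θ) z) 2 := by
  funext z; simp

/-- First derivatives of the conjugated field along `e₀`, as a vector. [folklore] -/
theorem fderiv_rotConj_single_zero (v : EuclideanSpace ℝ (Fin 3) → EuclideanSpace ℝ (Fin 3)) (θ : ℝ)
    (y : EuclideanSpace ℝ (Fin 3)) :
    fderiv ℝ (fun z => rotZ θ (v (rotZ (-θ) z))) y (EuclideanSpace.single 0 1) =
      rotZ θ (Real.cos θ • fderiv ℝ v (rotZ (-θ) y) (EuclideanSpace.single 0 1) -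
        Real.sin θ • fderiv ℝ v (rotZ (-θ) y) (EuclideanSpace.single 1 1)) := by
  rw [fderiv_rotConj, rotZ_neg_single_zero, map_sub, map_smul, map_smul]

/-- First derivatives of the conjugated field along `e₁`, as a vector. [folklore] -/
theorem fderiv_rotConj_single_one (v : EuclideanSpace ℝ (Fin 3) → EuclideanSpace ℝ (Fin 3)) (θ : ℝ)
    (y : EuclideanSpace ℝ (Fin 3)) :
    fderiv ℝ (fun z => rotZ θ (v (rotZ (-θ) z))) y (EuclideanSpace.single 1 1) =
      rotZ θ (Real.sin θ • fderiv ℝ v (rotZ (-θ) y) (EuclideanSpace.single 0 1) +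
        Real.cos θ • fderiv ℝ v (rotZ (-θ) y) (EuclideanSpace.single 1 1)) := by
  rw [fderiv_rotConj, rotZ_neg_single_one, map_add, map_smul, map_smul]

/-- First derivatives of the conjugated field along `e₂`, as a vector. [folklore] -/
theorem fderiv_rotConj_single_two (v : EuclideanSpace ℝ (Fin 3) → EuclideanSpace ℝ (Fin 3)) (θ : ℝ)
    (y : EuclideanSpace ℝ (Fin 3)) :
    fderiv ℝ (fun z => rotZ θ (v (rotZ (-θ) z))) y (EuclideanSpace.single 2 1) =
      rotZ θ (fderiv ℝ v (rotZ (-θ) y) (EuclideanSpace.single 2 1)) := by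
  rw [fderiv_rotConj, rotZ_apply_single_two]

/-- The vertical shear `y ↦ ∂₂u′₂(y)` of the conjugated field is `(∂₂v₂) ∘ R_{−θ}`. [folklore] -/
theorem fderiv_rotConj_vertShear (v : EuclideanSpace ℝ (Fin 3) → EuclideanSpace ℝ (Fin 3)) (θ : ℝ) :
    (fun z => fderiv ℝ (fun z' => rotZ θ (v (rotZ (-θ) z'))) z (EuclideanSpace.single 2 1) 2) =
      fun z => (fun x => fderiv ℝ v x (EuclideanSpace.single 2 1) 2) (rotZ (-θ) z) := by
  funext z
  rw [fderiv_rotConj_single_two, rotZ_apply_two]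

/-! ### The relocation: `hemptyHypNF` ⇐ `hemptyHypNFR` -/

/-- **The normal-form local (TH)∩twisting statement may assume `∂₀u₂(p₀) = 0 < ∂₁u₂(p₀)`.**  `hemptyHypNFR` is `hemptyHypNF`
(the binder `hNF` of `…TwistingTHLocalNormalForm.localTHEmptyHyp_of_normalForm`: `hemptyHyp` + non-umbilic pin + rest point)
with TWO MORE hypotheses `fderiv ℝ (u p₀.1) p₀.2 (EuclideanSpace.single 0 1) 2 = 0` and
`0 < fderiv ℝ (u p₀.1) p₀.2 (EuclideanSpace.single 1 1) 2` before `False`; then `hemptyHypNFR → hemptyHypNF` (conjugate by the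
horizontal rotation `R_θ` that turns `∇ₕu₂(p₀) ≠ 0` — non-zero by the twist pin — onto the positive `e₁`-axis). [folklore] -/
theorem localTHEmptyHypNF_of_rotation
    (hR : ∀ (u : ℝ → EuclideanSpace ℝ (Fin 3) → EuclideanSpace ℝ (Fin 3)) (μ A : ℝ → ℝ → ℝ)
      (U : Set (ℝ × EuclideanSpace ℝ (Fin 3))) (p₀ : ℝ × EuclideanSpace ℝ (Fin 3)),
      IsOpen U → p₀ ∈ U →
      AnalyticOnNhd ℝ (Function.uncurry u) U →
      (∀ p ∈ U, AnalyticAt ℝ (Function.uncurry μ) (p.1, p.2 2)) →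
      (∀ p ∈ U, AnalyticAt ℝ (Function.uncurry A) (p.1, p.2 2)) →
      (∀ p ∈ U, fderiv ℝ (u p.1) p.2 (EuclideanSpace.single 0 1) 1 = fderiv ℝ (u p.1) p.2 (EuclideanSpace.single 1 1) 0) →
      (∀ p ∈ U, fderiv ℝ (u p.1) p.2 (EuclideanSpace.single 0 1) 0 + fderiv ℝ (u p.1) p.2 (EuclideanSpace.single 1 1) 1 +
        fderiv ℝ (u p.1) p.2 (EuclideanSpace.single 2 1) 2 = 0) →
      (∀ p ∈ U, ∀ b : Fin 3, b ≠ 2 →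
        fderiv ℝ (u p.1) p.2 (EuclideanSpace.single 2 1) b =
          μ p.1 (p.2 2) * fderiv ℝ (u p.1) p.2 (EuclideanSpace.single b 1) 2) →
      (∀ p ∈ U,
        (1 - μ p.1 (p.2 2)) *
            (deriv (fun s => u s p.2 2) p.1 + fderiv ℝ (fun y => u p.1 y 2) p.2 (u p.1 p.2)
              - Δ (fun y => u p.1 y 2) p.2) =
          A p.1 (p.2 2) + (deriv (fun s => μ s (p.2 2)) p.1 - deriv (deriv (μ p.1)) (p.2 2)) * u p.1 p.2 2
            + deriv (μ p.1) (p.2 2) / 2 * u p.1 p.2 2 ^ 2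
            - 2 * deriv (μ p.1) (p.2 2) * fderiv ℝ (u p.1) p.2 (EuclideanSpace.single 2 1) 2) →
      fderiv ℝ (fun y => fderiv ℝ (u p₀.1) y (EuclideanSpace.single 2 1) 2) p₀.2 (EuclideanSpace.single 0 1) *
            fderiv ℝ (u p₀.1) p₀.2 (EuclideanSpace.single 1 1) 2 -
          fderiv ℝ (fun y => fderiv ℝ (u p₀.1) y (EuclideanSpace.single 2 1) 2) p₀.2 (EuclideanSpace.single 1 1) *
            fderiv ℝ (u p₀.1) p₀.2 (EuclideanSpace.single 0 1) 2 ≠ 0 →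
      μ p₀.1 (p₀.2 2) ≠ 0 → μ p₀.1 (p₀.2 2) ≠ 1 → deriv (μ p₀.1) (p₀.2 2) ≠ 0 →
      μ p₀.1 (p₀.2 2) < 0 →
      (fderiv ℝ (u p₀.1) p₀.2 (EuclideanSpace.single 0 1) 0 ≠ fderiv ℝ (u p₀.1) p₀.2 (EuclideanSpace.single 1 1) 1 ∨
        fderiv ℝ (u p₀.1) p₀.2 (EuclideanSpace.single 1 1) 0 ≠ 0) →
      u p₀.1 p₀.2 = 0 →
      fderiv ℝ (u p₀.1) p₀.2 (EuclideanSpace.single 0 1) 2 = 0 →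
      0 < fderiv ℝ (u p₀.1) p₀.2 (EuclideanSpace.single 1 1) 2 → False) :
    ∀ (u : ℝ → EuclideanSpace ℝ (Fin 3) → EuclideanSpace ℝ (Fin 3)) (μ A : ℝ → ℝ → ℝ)
      (U : Set (ℝ × EuclideanSpace ℝ (Fin 3))) (p₀ : ℝ × EuclideanSpace ℝ (Fin 3)),
      IsOpen U → p₀ ∈ U →
      AnalyticOnNhd ℝ (Function.uncurry u) U →
      (∀ p ∈ U, AnalyticAt ℝ (Function.uncurry μ) (p.1, p.2 2)) →
      (∀ p ∈ U, AnalyticAt ℝ (Function.uncurry A) (p.1, p.2 2)) →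
      (∀ p ∈ U, fderiv ℝ (u p.1) p.2 (EuclideanSpace.single 0 1) 1 = fderiv ℝ (u p.1) p.2 (EuclideanSpace.single 1 1) 0) →
      (∀ p ∈ U, fderiv ℝ (u p.1) p.2 (EuclideanSpace.single 0 1) 0 + fderiv ℝ (u p.1) p.2 (EuclideanSpace.single 1 1) 1 +
        fderiv ℝ (u p.1) p.2 (EuclideanSpace.single 2 1) 2 = 0) →
      (∀ p ∈ U, ∀ b : Fin 3, b ≠ 2 →
        fderiv ℝ (u p.1) p.2 (EuclideanSpace.single 2 1) b =
          μ p.1 (p.2 2) * fderiv ℝ (u p.1) p.2 (EuclideanSpace.single b 1) 2) →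
      (∀ p ∈ U,
        (1 - μ p.1 (p.2 2)) *
            (deriv (fun s => u s p.2 2) p.1 + fderiv ℝ (fun y => u p.1 y 2) p.2 (u p.1 p.2)
              - Δ (fun y => u p.1 y 2) p.2) =
          A p.1 (p.2 2) + (deriv (fun s => μ s (p.2 2)) p.1 - deriv (deriv (μ p.1)) (p.2 2)) * u p.1 p.2 2
            + deriv (μ p.1) (p.2 2) / 2 * u p.1 p.2 2 ^ 2
            - 2 * deriv (μ p.1) (p.2 2) * fderiv ℝ (u p.1) p.2 (EuclideanSpace.single 2 1) 2) →
      fderiv ℝ (fun y => fderiv ℝ (u p₀.1) y (EuclideanSpace.single 2 1) 2) p₀.2 (EuclideanSpace.single 0 1) *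
            fderiv ℝ (u p₀.1) p₀.2 (EuclideanSpace.single 1 1) 2 -
          fderiv ℝ (fun y => fderiv ℝ (u p₀.1) y (EuclideanSpace.single 2 1) 2) p₀.2 (EuclideanSpace.single 1 1) *
            fderiv ℝ (u p₀.1) p₀.2 (EuclideanSpace.single 0 1) 2 ≠ 0 →
      μ p₀.1 (p₀.2 2) ≠ 0 → μ p₀.1 (p₀.2 2) ≠ 1 → deriv (μ p₀.1) (p₀.2 2) ≠ 0 →
      μ p₀.1 (p₀.2 2) < 0 →
      (fderiv ℝ (u p₀.1) p₀.2 (EuclideanSpace.single 0 1) 0 ≠ fderiv ℝ (u p₀.1) p₀.2 (EuclideanSpace.single 1 1) 1 ∨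
        fderiv ℝ (u p₀.1) p₀.2 (EuclideanSpace.single 1 1) 0 ≠ 0) →
      u p₀.1 p₀.2 = 0 → False := by
  intro u μ A U p₀ hU hp₀ hu hμ hA hpol hdiv hsh hE htw hm0 hm1 hmz hneg hNU hrest
  obtain ⟨t₀, x₀⟩ := p₀
  dsimp only at hp₀ htw hm0 hm1 hmz hneg hNU hrest
  -- the horizontal gradient of `u₂` at `p₀` does not vanish (twist pin); the angle of the rotation
  set W0 : ℝ := fderiv ℝ (u t₀) x₀ (EuclideanSpace.single 0 1) 2 with hW0
  set W1 : ℝ := fderiv ℝ (u t₀) x₀ (EuclideanSpace.single 1 1) 2 with hW1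
  set zc : ℂ := ⟨W1, W0⟩ with hzc
  have hz : zc ≠ 0 := by
    intro h
    have h1 : W1 = 0 := by simpa [hzc] using congrArg Complex.re h
    have h0 : W0 = 0 := by simpa [hzc] using congrArg Complex.im h
    apply htw
    rw [h0, h1, mul_zero, mul_zero, sub_zero]
  set g : ℝ := ‖zc‖ with hg
  have hgpos : 0 < g := norm_pos_iff.mpr hz
  have hg2 : g ^ 2 = W1 ^ 2 + W0 ^ 2 := by
    rw [hg, Complex.sq_norm, Complex.normSq_apply]; ring
  set θ : ℝ := Complex.arg zc with hθ
  have hcos : Real.cos θ = W1 / g := by rw [hθ, Complex.cos_arg hz]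
  have hsin : Real.sin θ = W0 / g := by rw [hθ, Complex.sin_arg]
  have pyth : Real.cos θ ^ 2 + Real.sin θ ^ 2 = 1 := Real.cos_sq_add_sin_sq θ
  -- the rotated datum
  set u' : ℝ → EuclideanSpace ℝ (Fin 3) → EuclideanSpace ℝ (Fin 3) := fun s z => rotZ θ (u s (rotZ (-θ) z)) with hu'
  set U' : Set (ℝ × EuclideanSpace ℝ (Fin 3)) :=
    {p | ((p.1, rotZ (-θ) p.2) : ℝ × EuclideanSpace ℝ (Fin 3)) ∈ U} with hU'
  have hτc : Continuous (fun p : ℝ × EuclideanSpace ℝ (Fin 3) =>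
      ((p.1, rotZ (-θ) p.2) : ℝ × EuclideanSpace ℝ (Fin 3))) :=
    continuous_fst.prodMk ((rotZL (-θ)).continuous.comp continuous_snd)
  have hτa : ∀ p : ℝ × EuclideanSpace ℝ (Fin 3), AnalyticAt ℝ (fun p : ℝ × EuclideanSpace ℝ (Fin 3) =>
      ((p.1, rotZ (-θ) p.2) : ℝ × EuclideanSpace ℝ (Fin 3))) p := fun p =>
    analyticAt_fst.prod (((rotZL (-θ)).analyticAt _).comp analyticAt_snd)
  have hU'o : IsOpen U' := hU.preimage hτc
  have hx₀ : rotZ (-θ) (rotZ θ x₀) = x₀ := rotZ_neg_apply_rotZ θ x₀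
  have hp₀' : ((t₀, rotZ θ x₀) : ℝ × EuclideanSpace ℝ (Fin 3)) ∈ U' := by
    show ((t₀, rotZ (-θ) (rotZ θ x₀)) : ℝ × EuclideanSpace ℝ (Fin 3)) ∈ U
    rw [hx₀]; exact hp₀
  -- analyticity of the rotated datum
  have hu'a : AnalyticOnNhd ℝ (uncurry u') U' := by
    intro p hp
    have h := ((rotZL θ).analyticAt _).comp
      (AnalyticAt.comp (g := uncurry u)
        (f := fun p : ℝ × EuclideanSpace ℝ (Fin 3) => ((p.1, rotZ (-θ) p.2) : ℝ × EuclideanSpace ℝ (Fin 3)))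
        (hu _ hp) (hτa p))
    refine h.congr (Eventually.of_forall fun q => ?_)
    obtain ⟨s, z⟩ := q; rfl
  have hμ'a : ∀ p ∈ U', AnalyticAt ℝ (uncurry μ) (p.1, p.2 2) := fun p hp => by
    have h := hμ _ hp; rwa [rotZ_apply_two] at h
  have hA'a : ∀ p ∈ U', AnalyticAt ℝ (uncurry A) (p.1, p.2 2) := fun p hp => by
    have h := hA _ hp; rwa [rotZ_apply_two] at h
  -- first derivatives of the rotated field
  have hD0 : ∀ (t : ℝ) (y : EuclideanSpace ℝ (Fin 3)), fderiv ℝ (u' t) y (EuclideanSpace.single 0 1) =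
      rotZ θ (Real.cos θ • fderiv ℝ (u t) (rotZ (-θ) y) (EuclideanSpace.single 0 1) -
        Real.sin θ • fderiv ℝ (u t) (rotZ (-θ) y) (EuclideanSpace.single 1 1)) := fun t y => by
    rw [hu']; exact fderiv_rotConj_single_zero (u t) θ y
  have hD1 : ∀ (t : ℝ) (y : EuclideanSpace ℝ (Fin 3)), fderiv ℝ (u' t) y (EuclideanSpace.single 1 1) =
      rotZ θ (Real.sin θ • fderiv ℝ (u t) (rotZ (-θ) y) (EuclideanSpace.single 0 1) +
        Real.cos θ • fderiv ℝ (u t) (rotZ (-θ) y) (EuclideanSpace.single 1 1)) := fun t y => by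
    rw [hu']; exact fderiv_rotConj_single_one (u t) θ y
  have hD2 : ∀ (t : ℝ) (y : EuclideanSpace ℝ (Fin 3)), fderiv ℝ (u' t) y (EuclideanSpace.single 2 1) =
      rotZ θ (fderiv ℝ (u t) (rotZ (-θ) y) (EuclideanSpace.single 2 1)) := fun t y => by
    rw [hu']; exact fderiv_rotConj_single_two (u t) θ y
  -- the kinematic identities transfer
  have hpol' : ∀ p ∈ U', fderiv ℝ (u' p.1) p.2 (EuclideanSpace.single 0 1) 1 =
      fderiv ℝ (u' p.1) p.2 (EuclideanSpace.single 1 1) 0 := by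
    intro p hp
    have h := hpol _ hp
    dsimp only at h
    rw [hD0, hD1]
    simp only [rotZ_apply_zero, rotZ_apply_one, PiLp.sub_apply, PiLp.add_apply, PiLp.smul_apply, smul_eq_mul]
    linear_combination (Real.cos θ ^ 2 + Real.sin θ ^ 2) * h
  have hdiv' : ∀ p ∈ U', fderiv ℝ (u' p.1) p.2 (EuclideanSpace.single 0 1) 0 +
      fderiv ℝ (u' p.1) p.2 (EuclideanSpace.single 1 1) 1 + fderiv ℝ (u' p.1) p.2 (EuclideanSpace.single 2 1) 2 = 0 := by
    intro p hp
    have h := hdiv _ hp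
    dsimp only at h
    rw [hD0, hD1, hD2]
    simp only [rotZ_apply_zero, rotZ_apply_one, rotZ_apply_two, PiLp.sub_apply, PiLp.add_apply, PiLp.smul_apply,
      smul_eq_mul]
    linear_combination h + (fderiv ℝ (u p.1) (rotZ (-θ) p.2) (EuclideanSpace.single 0 1) 0 +
      fderiv ℝ (u p.1) (rotZ (-θ) p.2) (EuclideanSpace.single 1 1) 1) * pyth
  have hsh0' : ∀ p ∈ U', fderiv ℝ (u' p.1) p.2 (EuclideanSpace.single 2 1) 0 =
      μ p.1 (p.2 2) * fderiv ℝ (u' p.1) p.2 (EuclideanSpace.single 0 1) 2 := by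
    intro p hp
    have h0 := hsh _ hp 0 (by decide)
    have h1 := hsh _ hp 1 (by decide)
    dsimp only at h0 h1
    rw [rotZ_apply_two] at h0 h1
    rw [hD2, hD0]
    simp only [rotZ_apply_zero, rotZ_apply_two, PiLp.sub_apply, PiLp.smul_apply, smul_eq_mul]
    rw [h0, h1]; ring
  have hsh1' : ∀ p ∈ U', fderiv ℝ (u' p.1) p.2 (EuclideanSpace.single 2 1) 1 =
      μ p.1 (p.2 2) * fderiv ℝ (u' p.1) p.2 (EuclideanSpace.single 1 1) 2 := by
    intro p hp
    have h0 := hsh _ hp 0 (by decide)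
    have h1 := hsh _ hp 1 (by decide)
    dsimp only at h0 h1
    rw [rotZ_apply_two] at h0 h1
    rw [hD2, hD1]
    simp only [rotZ_apply_one, rotZ_apply_two, PiLp.add_apply, PiLp.smul_apply, smul_eq_mul]
    rw [h0, h1]; ring
  have hsh' : ∀ p ∈ U', ∀ b : Fin 3, b ≠ 2 → fderiv ℝ (u' p.1) p.2 (EuclideanSpace.single 2 1) b =
      μ p.1 (p.2 2) * fderiv ℝ (u' p.1) p.2 (EuclideanSpace.single b 1) 2 := by
    intro p hp b hb
    fin_cases b
    · exact hsh0' p hp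
    · exact hsh1' p hp
    · exact absurd rfl hb
  -- the scalar law transfers by rotation covariance
  have hE' : ∀ p ∈ U',
      (1 - μ p.1 (p.2 2)) *
          (deriv (fun s => u' s p.2 2) p.1 + fderiv ℝ (fun y => u' p.1 y 2) p.2 (u' p.1 p.2)
            - Δ (fun y => u' p.1 y 2) p.2) =
        A p.1 (p.2 2) + (deriv (fun s => μ s (p.2 2)) p.1 - deriv (deriv (μ p.1)) (p.2 2)) * u' p.1 p.2 2
          + deriv (μ p.1) (p.2 2) / 2 * u' p.1 p.2 2 ^ 2
          - 2 * deriv (μ p.1) (p.2 2) * fderiv ℝ (u' p.1) p.2 (EuclideanSpace.single 2 1) 2 := by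
    intro p hp
    obtain ⟨t, y⟩ := p
    have hq : ((t, rotZ (-θ) y) : ℝ × EuclideanSpace ℝ (Fin 3)) ∈ U := hp
    have h := hE _ hq
    dsimp only at h ⊢
    rw [rotZ_apply_two] at h
    have e1 : (fun s => u' s y 2) = fun s => u s (rotZ (-θ) y) 2 := by funext s; simp [hu']
    have e2 : (fun z => u' t z 2) = fun z => (fun x => u t x 2) (rotZ (-θ) z) := by funext z; simp [hu']
    have e3 : u' t y 2 = u t (rotZ (-θ) y) 2 := by simp [hu']
    have e4 : fderiv ℝ (fun z => (fun x => u t x 2) (rotZ (-θ) z)) y (u' t y) =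
        fderiv ℝ (fun x => u t x 2) (rotZ (-θ) y) (u t (rotZ (-θ) y)) := by
      rw [fderiv_comp_rotZ_neg (g := fun x => u t x 2), hu']; dsimp only; rw [rotZ_neg_apply_rotZ]
    rw [e1, e2, e3, e4, laplacian_comp_rotZ_neg (g := fun x => u t x 2), hD2, rotZ_apply_two]
    exact h
  -- the pins at `p₀′ = (t₀, R_θ x₀)`
  have hG : ∀ e : EuclideanSpace ℝ (Fin 3),
      fderiv ℝ (fun y => fderiv ℝ (u' t₀) y (EuclideanSpace.single 2 1) 2) (rotZ θ x₀) e =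
        fderiv ℝ (fun y => fderiv ℝ (u t₀) y (EuclideanSpace.single 2 1) 2) x₀ (rotZ (-θ) e) := fun e => by
    have hfun : (fun y => fderiv ℝ (u' t₀) y (EuclideanSpace.single 2 1) 2) =
        fun z => (fun x => fderiv ℝ (u t₀) x (EuclideanSpace.single 2 1) 2) (rotZ (-θ) z) := by
      rw [hu']; exact fderiv_rotConj_vertShear (u t₀) θ
    rw [hfun, fderiv_comp_rotZ_neg (g := fun x => fderiv ℝ (u t₀) x (EuclideanSpace.single 2 1) 2), hx₀]
  have hW' : ∀ e : EuclideanSpace ℝ (Fin 3), fderiv ℝ (u' t₀) (rotZ θ x₀) e 2 =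
      fderiv ℝ (u t₀) x₀ (rotZ (-θ) e) 2 := fun e => by
    rw [hu']; dsimp only; rw [fderiv_rotConj, rotZ_apply_two, hx₀]
  have hW'0 : fderiv ℝ (u' t₀) (rotZ θ x₀) (EuclideanSpace.single 0 1) 2 = 0 := by
    rw [hW', rotZ_neg_single_zero, map_sub, map_smul, map_smul, PiLp.sub_apply, PiLp.smul_apply, PiLp.smul_apply,
      smul_eq_mul, smul_eq_mul, ← hW0, ← hW1, hcos, hsin]
    field_simp
    ring
  have hW'1 : fderiv ℝ (u' t₀) (rotZ θ x₀) (EuclideanSpace.single 1 1) 2 = g := by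
    rw [hW', rotZ_neg_single_one, map_add, map_smul, map_smul, PiLp.add_apply, PiLp.smul_apply, PiLp.smul_apply,
      smul_eq_mul, smul_eq_mul, ← hW0, ← hW1, hcos, hsin]
    field_simp
    nlinarith [hg2]
  refine hR u' μ A U' (t₀, rotZ θ x₀) hU'o hp₀' hu'a hμ'a hA'a hpol' hdiv' hsh' hE' ?_ ?_ ?_ ?_ ?_ ?_ ?_ hW'0 ?_
  · -- twist: an `SO(2)` invariant
    dsimp only
    rw [hG, hG, hW', hW', rotZ_neg_single_zero, rotZ_neg_single_one]
    simp only [map_sub, map_add, map_smul, PiLp.sub_apply, PiLp.add_apply, PiLp.smul_apply, smul_eq_mul]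
    rw [← hW0, ← hW1]
    intro h
    apply htw
    linear_combination h -
      (fderiv ℝ (fun y => fderiv ℝ (u t₀) y (EuclideanSpace.single 2 1) 2) x₀ (EuclideanSpace.single 0 1) * W1 -
        fderiv ℝ (fun y => fderiv ℝ (u t₀) y (EuclideanSpace.single 2 1) 2) x₀ (EuclideanSpace.single 1 1) * W0) * pyth
  · dsimp only; rw [rotZ_apply_two]; exact hm0
  · dsimp only; rw [rotZ_apply_two]; exact hm1
  · dsimp only; rw [rotZ_apply_two]; exact hmz
  · dsimp only; rw [rotZ_apply_two]; exact hneg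
  · -- the non-umbilic pin: the traceless horizontal strain is rotated by `2θ`
    dsimp only
    rw [hD0, hD1, hx₀]
    simp only [rotZ_apply_zero, rotZ_apply_one, PiLp.sub_apply, PiLp.add_apply, PiLp.smul_apply, smul_eq_mul]
    have hp := hpol _ hp₀
    dsimp only at hp
    rw [hp]
    set a : ℝ := fderiv ℝ (u t₀) x₀ (EuclideanSpace.single 0 1) 0 with ha
    set b : ℝ := fderiv ℝ (u t₀) x₀ (EuclideanSpace.single 1 1) 0 with hb
    set d : ℝ := fderiv ℝ (u t₀) x₀ (EuclideanSpace.single 1 1) 1 with hd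
    by_contra hcon
    simp only [not_or, ne_eq, not_not] at hcon
    obtain ⟨h1, h2⟩ := hcon
    have key : (a - d) ^ 2 + (2 * b) ^ 2 = 0 := by
      have e : (a - d) ^ 2 + (2 * b) ^ 2 =
          (Real.cos θ * (Real.cos θ * a - Real.sin θ * b) - Real.sin θ * (Real.cos θ * b - Real.sin θ * d) -
              (Real.sin θ * (Real.sin θ * a + Real.cos θ * b) + Real.cos θ * (Real.sin θ * b + Real.cos θ * d))) ^ 2 +
            (2 * (Real.cos θ * (Real.sin θ * a + Real.cos θ * b) - Real.sin θ * (Real.sin θ * b + Real.cos θ * d))) ^ 2 := by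
        linear_combination (-(Real.cos θ ^ 2 + Real.sin θ ^ 2 + 1) * ((a - d) ^ 2 + (2 * b) ^ 2)) * pyth
      rw [e, h1, h2]; ring
    have h3 : (a - d) ^ 2 = 0 := by linarith [sq_nonneg (a - d), sq_nonneg (2 * b)]
    have h4 : (2 * b) ^ 2 = 0 := by linarith [sq_nonneg (a - d), sq_nonneg (2 * b)]
    rw [pow_eq_zero_iff two_ne_zero] at h3 h4
    rcases hNU with hne | hne
    · exact hne (by linarith)
    · exact hne (by linarith)
  · -- rest point
    dsimp only; rw [hu']; dsimp only; rw [hx₀, hrest]; ext i; fin_cases i <;> simp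
  · rw [hW'1]; exact hgpos

end Summit.NavierStokesRegularity.NavierStokesRegularity.Theorems.PoloidalWindowDoorLrcModEntireTwistingTHLocalRotation

end
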